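import Summits.ResolutionOfSingularities.ResolutionOfSingularities.Theorems.WildConesCampaignW46HypersurfacesCharTwoBlowupInjective

/-!
# [OURS · L1 W4.6, rung (ii) at p = 2, EVERY dimension n, EVERY corank e] THE EXACT LOCUS OF THE
# INFINITELY-NEAR DOUBLE POINTS: a double successor sits at `(i, τ)` IFF the near vector
# `w = (τ with w_i = 1)` is in the KERNEL OF THE POLAR FORM and ON THE TANGENT CUBIC, `w·P = 0 ∧ a₃(w) = 0`
# — `z² = a(u₁,…,uₙ)` over every field of characteristic 2

HONEST FRAMING. Everything here is OURS: theorems about route WildCones' own TYPED point-blow-up dynamics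
(`Theorems/WildConesClassicalRegimesDefs.lean`: states `c`, `step i τ c` = blow up the point, chart `u_i`,
translate by `τ`, delete squares; `MultP` = double point, `Isol` = finite Milnor algebra, `mu`, `OrdP`)
and the seat's invariants `polarMatrix` (p502936), `milnorEmbDim` (p498937: `e(c) = dim ker P`) and
`degForm` (p522667: `degForm 3 (ser c) w = a₃(w)`, the tangent cubic). NOTHING here is a statement of the
manuscript [Hironaka2017]; no FACT-LIST premise; AI review is weaker than expert review. Cell res-hironaka
(LADDER-RESOLUTION rung L, D-0089), slot W4.6, seat res-L1-s46-pv-4 (gen 5); host route `WildCones`, crux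
`ClassicalRegimes` (stmt-ResolutionOfSingularities-16884; proved).

WHY / WHAT. The linear part of the strict transform `T` at `(i, τ)` is now completely explicit:
`[u_m] T = (w·P)_m` off the chart index (gen 3, `coeff_single_serT_eq_vecMul`) and `[u_i] T = a₃(w)`
(gen 5, `coeff_single_serT_self`); a successor is a double point iff these vanish and the cleaned
successor is non-zero, which holds for every ISOLATED double state (gen 5, `hypersurface_ser_step_ne_zero`)
and for every order-2-cleaned one (gen 2, `ser_step_ne_zero_of_ordP`). Hence:

* `hypersurface_cubic_eq_zero_of_double_successor` — a double successor forces `a₃(w) = 0` (no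
  hypothesis on `c` beyond `MultP`); with `vecMul_nearPoint_polarMatrix`: `w·P = 0 ∧ a₃(w) = 0`.
* `hypersurface_multP_step_of_ker_of_cubic` — conversely `w·P = 0`, `a₃(w) = 0` and a non-zero
  successor give a double successor.
* `hypersurface_multP_step_iff` — **THE NEAR-POINT CRITERION**: for an isolated double state,
  `MultP (step i τ c) ↔ w·P = 0 ∧ degForm 3 (ser c) w = 0`; `hypersurface_multP_step_iff_of_ordP` — the
  same for order-2-cleaned states without isolatedness. The infinitely-near double points are the
  points of the PROJECTIVE KERNEL `ℙ(ker P) ≅ ℙ^{e−1}` lying on the cubic `a₃ = 0`: for `e = 0` none,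
  for `e = 1` the one kernel point iff `a₃` vanishes there, for `e = 2` a line cut by a cubic (≤ 3
  points, or the whole line), for `e ≥ 3` a cubic hypersurface section. It replaces the role of the
  DESCRIPTION of the next centre `D′ = ∇′ ∩ π⁻¹(D)` of Th. 16.6 (p.84) in this regime — NOT a statement
  of the manuscript.
* `hypersurface_multP_step_rescale` — the criterion is projective: the same point of the exceptional
  divisor read in another chart `i'` (`w_{i'} ≠ 0`, `τ' = w/w_{i'}`) is again a double successor.
* `hypersurface_exists_double_successor_iff_cubic` (`e = 1`, kernel vector `w₀`): a double successor
  exists iff `a₃(w₀) = 0`; with gen 3 (`…_iff_four_le_mu`, `n ≥ 3`):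
  `hypersurface_mu_eq_two_iff_cubic_ne_zero` — **`μ = 2` iff the tangent cubic does not vanish at the
  kernel point** (the `A₁`-versus-deeper test in characteristic two, every `n ≥ 3`).

References: G.-M. Greuel, G. Pfister, J. Algebra 689 (2026) [GreuelPfister2026] (context: `A₁` in char 2);
H. Hironaka, ms. 2017 [Hironaka2017] Th. 16.6 p.84 — role replaced only, under adjudication.
-/

noncomputable section

-- single-problem summit: the doubled namespace component `ResolutionOfSingularities` is forced
set_option linter.dupNamespace false

open scoped BigOperators Classical

open MvPowerSeries IsLocalRing

open Literature.AlgebraicGeometry.Resolution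

namespace Summit.ResolutionOfSingularities.ResolutionOfSingularities.Theorems

namespace CampaignW46.HypersurfacesCharTwo

open WildCones WildCones.MuDropCharTwoOrdP ThreefoldsCharTwo

variable {κ : Type} [Field κ] {n : ℕ}

/-! ## A double successor lies on the tangent cubic -/

/-- [OURS · L1 W4.6 rung (ii) at `p = 2`, every dimension; NOT a statement of the manuscript] **A DOUBLE
SUCCESSOR LIES ON THE TANGENT CUBIC**: if a double state `c` of `z² = a(u₁,…,uₙ)` (characteristic `2`)
has a double point as successor in chart `i` at translation `τ`, then `a₃(w) = 0` for the near vector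
`w = (τ with w_i = 1)` (the `u_i`-coefficient of the strict transform, `coeff_single_serT_self`, must
vanish, `coeff_single_serT`). [folklore] -/
theorem hypersurface_cubic_eq_zero_of_double_successor [CharP κ 2] (c : (Fin n → ℕ) → κ) (i : Fin n)
    (τ : Fin n → κ) (hM : MultP 2 n κ c) (hM' : MultP 2 n κ (step 2 n κ i τ c)) :
    degForm 3 (ser 2 n κ c) (Function.update τ i 1) = 0 := by
  rw [← coeff_single_serT_self c i τ hM]
  exact coeff_single_serT le_rfl c i τ hM hM' i

/-- [OURS · L1 W4.6 rung (ii) at `p = 2`, every dimension; NOT a statement of the manuscript] **A double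
successor lies in the kernel of the polar form AND on the tangent cubic** (`vecMul_nearPoint_polarMatrix`
of gen 3 and the previous theorem). [folklore] -/
theorem hypersurface_ker_and_cubic_of_double_successor [CharP κ 2] (c : (Fin n → ℕ) → κ) (i : Fin n)
    (τ : Fin n → κ) (hM : MultP 2 n κ c) (hM' : MultP 2 n κ (step 2 n κ i τ c)) :
    Matrix.vecMul (Function.update τ i 1) (polarMatrix (ser 2 n κ c)) = 0 ∧
      degForm 3 (ser 2 n κ c) (Function.update τ i 1) = 0 :=
  ⟨vecMul_nearPoint_polarMatrix c i τ hM hM', hypersurface_cubic_eq_zero_of_double_successor c i τ hM hM'⟩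

/-! ## The converse: kernel and cubic give a double successor -/

/-- [OURS · L1 W4.6 rung (ii) at `p = 2`, every dimension; NOT a statement of the manuscript] **KERNEL
AND CUBIC GIVE A DOUBLE SUCCESSOR**: if the near vector `w = (τ with w_i = 1)` of `(i, τ)` satisfies
`w·P = 0` and `a₃(w) = 0`, and the cleaned successor is non-zero, then the successor is a double point:
otherwise it would have a linear monomial `u_m` (`exists_linear_of_not_multP`), whose coefficient is
`(w·P)_m` for `m ≠ i` and `a₃(w)` for `m = i`. [folklore] -/
theorem hypersurface_multP_step_of_ker_of_cubic [CharP κ 2] (c : (Fin n → ℕ) → κ) (i : Fin n)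
    (τ : Fin n → κ) (hM : MultP 2 n κ c) (hne : ser 2 n κ (step 2 n κ i τ c) ≠ 0)
    (hker : Matrix.vecMul (Function.update τ i 1) (polarMatrix (ser 2 n κ c)) = 0)
    (hcub : degForm 3 (ser 2 n κ c) (Function.update τ i 1) = 0) :
    MultP 2 n κ (step 2 n κ i τ c) := by
  by_contra hM'
  obtain ⟨A, hA, hdeg⟩ := exists_linear_of_not_multP hne hM'
  have hdeg' : (Finsupp.equivFunOnFinite.symm A).degree = 1 := by
    rw [Finsupp.degree_eq_sum]
    exact hdeg
  obtain ⟨m, hm⟩ := exists_eq_single_of_degree_eq_one hdeg'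
  have hAm : A = ⇑(Finsupp.single m 1 : Fin n →₀ ℕ) := by
    rw [← hm]
    rfl
  have hlin : coeff (Finsupp.single m 1) (show MvPowerSeries (Fin n) κ from
      fun A : Fin n →₀ ℕ => tr n κ i τ 2 (dv n κ i 2 (bl n κ i (clean 2 n κ c))) ⇑A) ≠ 0 := by
    have hm1 : ¬ 2 ∣ (⇑(Finsupp.single m 1 : Fin n →₀ ℕ)) m := by simp
    have h := hA
    rw [hAm, OrdPExitSurface.step_eq i τ hM, CaseAExitOrdSucc.clean_clean,
      OrdPExitSurface.clean_apply_of_not_dvd _ _ m hm1] at h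
    exact h
  by_cases hmi : m = i
  · subst hmi
    rw [coeff_single_serT_self c m τ hM] at hlin
    exact hlin hcub
  · rw [coeff_single_serT_eq_vecMul c i τ hM hmi, hker, Pi.zero_apply] at hlin
    exact hlin rfl

/-! ## The near-point criterion -/

/-- [OURS · L1 W4.6 rung (ii) at `p = 2`, EVERY dimension `n`, EVERY corank `e`; NOT a statement of the
manuscript] **THE NEAR-POINT CRITERION.** Let `c` be an ISOLATED double state of `z² = a(u₁,…,uₙ)` over
any field of characteristic `2`, `P` the polar matrix of its cleaned quadratic part and `a₃` its cubic
form. Then the point-blow-up successor in chart `i` at translation `τ` is a DOUBLE POINT if and only if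
the near vector `w = (τ with w_i = 1)` — the homogeneous coordinates of the visited point of the
exceptional divisor — satisfies
`w · P = 0` and `a₃(w) = degForm 3 (ser c) w = 0`.
So the infinitely-near double points of `c` are exactly the points of the projective kernel
`ℙ(ker P) ≅ ℙ^{e(c)−1}` on the cubic `a₃ = 0`. (`→`: `hypersurface_ker_and_cubic_of_double_successor`;
`←`: `hypersurface_multP_step_of_ker_of_cubic` with `hypersurface_ser_step_ne_zero`.) It replaces the
role of the description of the next centre `D′ = ∇′ ∩ π⁻¹(D)` (Th. 16.6 p.84 L5–L6) for hypersurface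
double points in characteristic two — NOT a statement of the manuscript. [folklore] -/
theorem hypersurface_multP_step_iff [CharP κ 2] (c : (Fin n → ℕ) → κ) (i : Fin n) (τ : Fin n → κ)
    (hM : MultP 2 n κ c) (hI : Isol 2 n κ c) :
    MultP 2 n κ (step 2 n κ i τ c) ↔
      Matrix.vecMul (Function.update τ i 1) (polarMatrix (ser 2 n κ c)) = 0 ∧
        degForm 3 (ser 2 n κ c) (Function.update τ i 1) = 0 :=
  ⟨hypersurface_ker_and_cubic_of_double_successor c i τ hM,
    fun h => hypersurface_multP_step_of_ker_of_cubic c i τ hM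
      (hypersurface_ser_step_ne_zero c i τ hM hI) h.1 h.2⟩

/-- [OURS · L1 W4.6 rung (ii) at `p = 2`, every dimension; NOT a statement of the manuscript] **The
near-point criterion for ORDER-2-CLEANED states** (a hyperbolic pair in the cleaned quadratic part,
`OrdP`; no isolatedness needed): `MultP (step i τ c) ↔ w·P = 0 ∧ a₃(w) = 0`. [folklore] -/
theorem hypersurface_multP_step_iff_of_ordP [CharP κ 2] (c : (Fin n → ℕ) → κ) (i : Fin n)
    (τ : Fin n → κ) (hM : MultP 2 n κ c) (hO : OrdP 2 n κ c) :
    MultP 2 n κ (step 2 n κ i τ c) ↔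
      Matrix.vecMul (Function.update τ i 1) (polarMatrix (ser 2 n κ c)) = 0 ∧
        degForm 3 (ser 2 n κ c) (Function.update τ i 1) = 0 :=
  ⟨hypersurface_ker_and_cubic_of_double_successor c i τ hM,
    fun h => hypersurface_multP_step_of_ker_of_cubic c i τ hM
      (ser_step_ne_zero_of_ordP c i τ hM hO) h.1 h.2⟩

/-! ## The criterion is projective -/

/-- [OURS · L1 W4.6] Rescaling a vector with `w_{i'} ≠ 0` to `i'`-th coordinate `1` is an `update`:
`(w_{i'})⁻¹ • w = ((w_{i'})⁻¹ • w with i' ↦ 1)`. [folklore] -/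
theorem update_inv_smul_eq {w : Fin n → κ} {i' : Fin n} (hw : w i' ≠ 0) :
    Function.update ((w i')⁻¹ • w) i' 1 = (w i')⁻¹ • w := by
  funext s
  by_cases hs : s = i'
  · rw [hs, Function.update_self, Pi.smul_apply, smul_eq_mul, inv_mul_cancel₀ hw]
  · rw [Function.update_of_ne hs]

/-- [OURS · L1 W4.6 rung (ii) at `p = 2`, every dimension; NOT a statement of the manuscript] **THE
NEAR-POINT CRITERION IS PROJECTIVE**: both conditions `w·P = 0`, `a₃(w) = 0` are homogeneous in `w`, so
for an isolated double state a double successor at `(i, τ)` with `w_{i'} ≠ 0` (`w = (τ with w_i = 1)`)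
is seen again in chart `i'` at `τ' = w / w_{i'}`: the infinitely-near double points form a well-defined
subset of the exceptional divisor `ℙ^{n-1}`, independent of the chart used to visit them (for `e ≤ 1`
gen 3's `hypersurface_nearPoint_charts` said the same by uniqueness). [folklore] -/
theorem hypersurface_multP_step_rescale [CharP κ 2] (c : (Fin n → ℕ) → κ) (i i' : Fin n)
    (τ : Fin n → κ) (hM : MultP 2 n κ c) (hI : Isol 2 n κ c) (hM' : MultP 2 n κ (step 2 n κ i τ c))
    (hw : Function.update τ i 1 i' ≠ 0) :
    MultP 2 n κ (step 2 n κ i' ((Function.update τ i 1 i')⁻¹ • Function.update τ i 1) c) := by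
  obtain ⟨hker, hcub⟩ := (hypersurface_multP_step_iff c i τ hM hI).mp hM'
  refine (hypersurface_multP_step_iff c i' _ hM hI).mpr ?_
  rw [update_inv_smul_eq hw]
  refine ⟨?_, ?_⟩
  · rw [Matrix.smul_vecMul, hker, smul_zero]
  · rw [degForm_smul_vec, hcub, mul_zero]

/-- [OURS · L1 W4.6 rung (ii) at `p = 2`, every dimension; NOT a statement of the manuscript] **Every
non-zero vector of the kernel on the cubic IS a near double point** (isolated double state): if
`w ≠ 0`, `w·P = 0`, `a₃(w) = 0`, then in the chart `i` of any non-zero coordinate `w_i ≠ 0`, at the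
translation `τ = w / w_i`, the successor is a double point. [folklore] -/
theorem hypersurface_multP_step_of_vec [CharP κ 2] (c : (Fin n → ℕ) → κ) (hM : MultP 2 n κ c)
    (hI : Isol 2 n κ c) {w : Fin n → κ} {i : Fin n} (hwi : w i ≠ 0)
    (hker : Matrix.vecMul w (polarMatrix (ser 2 n κ c)) = 0) (hcub : degForm 3 (ser 2 n κ c) w = 0) :
    MultP 2 n κ (step 2 n κ i ((w i)⁻¹ • w) c) := by
  refine (hypersurface_multP_step_iff c i _ hM hI).mpr ?_
  rw [update_inv_smul_eq hwi]
  exact ⟨by rw [Matrix.smul_vecMul, hker, smul_zero], by rw [degForm_smul_vec, hcub, mul_zero]⟩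

/-! ## Corank one: the kernel point and the tangent cubic decide `μ = 2` -/

/-- [OURS · L1 W4.6] In corank one every kernel vector is a multiple of a given non-zero kernel vector.
[folklore] -/
theorem exists_smul_of_ker_of_milnorEmbDim_eq_one [CharP κ 2] {c : (Fin n → ℕ) → κ} (hM : MultP 2 n κ c)
    (he : milnorEmbDim 2 n κ c = 1) {w₀ : Fin n → κ} (hw₀ : w₀ ≠ 0)
    (hker₀ : Matrix.vecMul w₀ (polarMatrix (ser 2 n κ c)) = 0) {w : Fin n → κ}
    (hker : Matrix.vecMul w (polarMatrix (ser 2 n κ c)) = 0) : ∃ r : κ, w = r • w₀ := by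
  set K := LinearMap.ker (polarMatrix (ser 2 n κ c)).mulVecLin with hK
  have hfr : Module.finrank κ K = 1 := by rw [hK, finrank_ker_polarMatrix hM, he]
  have hw₀K : w₀ ∈ K := (mem_ker_polarMatrix_iff _ _).mpr hker₀
  have hwK : w ∈ K := (mem_ker_polarMatrix_iff _ _).mpr hker
  obtain ⟨r, hr⟩ := (finrank_eq_one_iff_of_nonzero' (⟨w₀, hw₀K⟩ : K)
    (fun h => hw₀ (congrArg Subtype.val h))).mp hfr ⟨w, hwK⟩
  exact ⟨r, (congrArg Subtype.val hr).symm⟩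

/-- [OURS · L1 W4.6 rung (ii) at `p = 2`, every dimension; NOT a statement of the manuscript] **CORANK
ONE: A DOUBLE SUCCESSOR EXISTS IFF THE TANGENT CUBIC VANISHES AT THE KERNEL POINT.** Let `c` be an
isolated double state with `e(c) = 1` and `w₀ ≠ 0` a kernel vector of the polar form (`w₀·P = 0`; the
kernel is the line `κ w₀`). Then some chart and translation give a double successor iff `a₃(w₀) = 0`.
(Any near vector is `r w₀` with `r ≠ 0`, and `a₃(r w₀) = r³ a₃(w₀)`.) [folklore] -/
theorem hypersurface_exists_double_successor_iff_cubic [CharP κ 2] (c : (Fin n → ℕ) → κ)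
    (hM : MultP 2 n κ c) (hI : Isol 2 n κ c) (he : milnorEmbDim 2 n κ c = 1) {w₀ : Fin n → κ}
    (hw₀ : w₀ ≠ 0) (hker₀ : Matrix.vecMul w₀ (polarMatrix (ser 2 n κ c)) = 0) :
    (∃ (i : Fin n) (τ : Fin n → κ), MultP 2 n κ (step 2 n κ i τ c)) ↔ degForm 3 (ser 2 n κ c) w₀ = 0 := by
  constructor
  · rintro ⟨i, τ, hM'⟩
    obtain ⟨hker, hcub⟩ := (hypersurface_multP_step_iff c i τ hM hI).mp hM'
    obtain ⟨r, hr⟩ := exists_smul_of_ker_of_milnorEmbDim_eq_one hM he hw₀ hker₀ hker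
    have hr0 : r ≠ 0 := by
      intro h0
      have h1 := congrFun hr i
      rw [Function.update_self, h0, zero_smul, Pi.zero_apply] at h1
      exact one_ne_zero h1
    rw [hr, degForm_smul_vec] at hcub
    exact (mul_eq_zero.mp hcub).resolve_left (pow_ne_zero 3 hr0)
  · intro hcub
    obtain ⟨i, hi⟩ : ∃ i, w₀ i ≠ 0 := by
      by_contra h
      push Not at h
      exact hw₀ (funext h)
    exact ⟨i, _, hypersurface_multP_step_of_vec c hM hI hi hker₀ hcub⟩

/-- [OURS · L1 W4.6 rung (ii) at `p = 2`, every dimension `n ≥ 3`; NOT a statement of the manuscript]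
**`μ = 2` IFF THE TANGENT CUBIC DOES NOT VANISH AT THE KERNEL POINT** (corank one, isolated; `w₀ ≠ 0` a
kernel vector of the polar form): combining the previous theorem with gen 3's
`hypersurface_exists_double_successor_iff_four_le_mu` (a double successor exists iff `μ ≥ 4`) and
`μ` even `≥ 2` (`curvilinear_of_milnorEmbDim_eq_one`). In characteristic two this is the explicit test
separating the node-like double point (`μ = 2`, resolved by one blow-up) from the deeper curvilinear
ones (`μ ≥ 4`), read off the 3-jet. [cite: GreuelPfister2026, Thm 3.5 and Cor 3.7] -/
theorem hypersurface_mu_eq_two_iff_cubic_ne_zero [CharP κ 2] (hn : 3 ≤ n) (c : (Fin n → ℕ) → κ)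
    (hM : MultP 2 n κ c) (hI : Isol 2 n κ c) (he : milnorEmbDim 2 n κ c = 1) {w₀ : Fin n → κ}
    (hw₀ : w₀ ≠ 0) (hker₀ : Matrix.vecMul w₀ (polarMatrix (ser 2 n κ c)) = 0) :
    mu 2 n κ c = 2 ↔ degForm 3 (ser 2 n κ c) w₀ ≠ 0 := by
  rw [← hypersurface_resolved_in_one_iff_mu_eq_two hn c hM hI he, Ne,
    ← hypersurface_exists_double_successor_iff_cubic c hM hI he hw₀ hker₀]
  constructor
  · rintro h ⟨i, τ, hiτ⟩
    exact h i τ hiτ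
  · intro h i τ hiτ
    exact h ⟨i, τ, hiτ⟩

/-- [OURS · L1 W4.6 rung (ii) at `p = 2`, every dimension `n ≥ 3`; NOT a statement of the manuscript]
**`μ ≥ 4` IFF THE TANGENT CUBIC VANISHES AT THE KERNEL POINT** (corank one, isolated). [folklore] -/
theorem hypersurface_four_le_mu_iff_cubic_eq_zero [CharP κ 2] (hn : 3 ≤ n) (c : (Fin n → ℕ) → κ)
    (hM : MultP 2 n κ c) (hI : Isol 2 n κ c) (he : milnorEmbDim 2 n κ c = 1) {w₀ : Fin n → κ}
    (hw₀ : w₀ ≠ 0) (hker₀ : Matrix.vecMul w₀ (polarMatrix (ser 2 n κ c)) = 0) :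
    4 ≤ mu 2 n κ c ↔ degForm 3 (ser 2 n κ c) w₀ = 0 := by
  rw [← hypersurface_exists_double_successor_iff_four_le_mu hn c hM hI he,
    hypersurface_exists_double_successor_iff_cubic c hM hI he hw₀ hker₀]

end CampaignW46.HypersurfacesCharTwo

end Summit.ResolutionOfSingularities.ResolutionOfSingularities.Theorems

end
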